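import Summits.QuantumAdvantage.QuantumAdvantage.Theorems.CharDialMaskDialB
import HarnessLib

/-!
# The mask dial, part C: the free-masked-block TAIL (decomp-qadv lens-6 g18 «NullDial» REV2, tree part 31E)

Port of tree part 30P (`BlockDial.card_few_const_le_half`) from constant `p`-blocks to MASKED blocks `zblk ℓ S Z k` (part 31C) of a common size
`m ≥ 1`: with `M ≥ 2^m (T+1)` masked blocks, at most HALF of all inputs are constant on `≤ T` of them (moment method at `z = 1/2`, merging on the
masked block; `sum_sum_merge` and `qpow_le_half` are cited from 30P by name).
Supports item stmt-QuantumAdvantage-32604 (`CharDial.WalkHardFJLinOdd`); source: pub annex g18/OrbitDial38.lean REV2 (sha256 7aeccba348e162ea…) §38g, namespace `…Theses.OrbitDial.MaskDial`,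
statements and proofs verbatim (Prop-free).
-/

set_option autoImplicit false

namespace Summit.QuantumAdvantage.AdviceFreeQNC0.JLinPeel.MaskDial

open Finset
open Summit.QuantumAdvantage.AdviceFreeQNC0
open Summit.QuantumAdvantage.AdviceFreeQNC0.JLinPeel.BlockDial
open Literature.Computability.MetaComplexity Literature.Computability.MetaComplexity.Smolensky

section MaskTail
open Classical
variable {n M : ℕ} {ℓ m : ℕ} {S : Fin M → ℕ} {Z : Finset (Fin n)}

/-- free masked blocks among the first `j`. -/
noncomputable def cblkLTZ (ℓ : ℕ) (S : Fin M → ℕ) (Z : Finset (Fin n)) (j : ℕ) (u : Fin n → Bool) : Finset (Fin M) :=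
  univ.filter fun k => k.val < j ∧ (∀ x₁ ∈ zblk ℓ S Z k, ∀ x₂ ∈ zblk ℓ S Z k, u x₁ = u x₂)

/-- the half-weight `(1/2)^{# free masked blocks among the first j}`. -/
noncomputable def ZwZ (ℓ : ℕ) (S : Fin M → ℕ) (Z : Finset (Fin n)) (j : ℕ) (u : Fin n → Bool) : ℝ := (1 / 2 : ℝ) ^ (cblkLTZ ℓ S Z j u).card

/-- no blocks before index `0`. -/
theorem cblkLTZ_zero (u : Fin n → Bool) : cblkLTZ ℓ S Z 0 u = ∅ := by
  unfold cblkLTZ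
  rw [Finset.filter_eq_empty_iff]
  rintro k - ⟨hk, -⟩
  omega

/-- all `M` blocks are before index `M`. -/
theorem cblkLTZ_M (u : Fin n → Bool) : cblkLTZ ℓ S Z M u = cblkZ ℓ S Z u := by
  unfold cblkLTZ cblkZ
  refine Finset.filter_congr fun k _ => ?_
  exact ⟨fun h => h.2, fun h => ⟨k.isLt, h⟩⟩

/-- one more block: the count of free masked blocks grows by the indicator of block `j`. -/
theorem card_cblkLTZ_succ {j : ℕ} (hj : j < M) (u : Fin n → Bool) :
    (cblkLTZ ℓ S Z (j + 1) u).card = (cblkLTZ ℓ S Z j u).card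
      + (if (∀ x₁ ∈ zblk ℓ S Z ⟨j, hj⟩, ∀ x₂ ∈ zblk ℓ S Z ⟨j, hj⟩, u x₁ = u x₂) then 1 else 0) := by
  by_cases hc : (∀ x₁ ∈ zblk ℓ S Z ⟨j, hj⟩, ∀ x₂ ∈ zblk ℓ S Z ⟨j, hj⟩, u x₁ = u x₂)
  · rw [if_pos hc]
    have e : cblkLTZ ℓ S Z (j + 1) u = insert ⟨j, hj⟩ (cblkLTZ ℓ S Z j u) := by
      ext k
      rw [cblkLTZ, cblkLTZ, mem_insert, mem_filter, mem_filter, Fin.ext_iff]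
      simp only [mem_univ, true_and]
      constructor
      · rintro ⟨hk, hck⟩
        by_cases hkj : k.val = j
        · exact Or.inl hkj
        · exact Or.inr ⟨by omega, hck⟩
      · rintro (hkj | ⟨hk, hck⟩)
        · refine ⟨by omega, ?_⟩
          have hkk : k = ⟨j, hj⟩ := Fin.ext hkj
          rw [hkk]
          exact hc
        · exact ⟨by omega, hck⟩
    have hnot : (⟨j, hj⟩ : Fin M) ∉ cblkLTZ ℓ S Z j u := by
      rw [cblkLTZ, mem_filter]
      simp
    rw [e, Finset.card_insert_of_notMem hnot]
  · rw [if_neg hc, add_zero]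
    congr 1
    ext k
    rw [cblkLTZ, cblkLTZ, mem_filter, mem_filter]
    simp only [mem_univ, true_and]
    constructor
    · rintro ⟨hk, hck⟩
      refine ⟨?_, hck⟩
      by_contra hkj
      have hkk : k = ⟨j, hj⟩ := Fin.ext (by simp; omega)
      rw [hkk] at hck
      exact hc hck
    · rintro ⟨hk, hck⟩
      exact ⟨by omega, hck⟩

/-- merging foreign bits into the masked block `k₀` does not change constancy on the other masked blocks. -/
theorem isConstZ_merge_of_ne (h : ((∀ k k', k < k' → S k + ℓ ≤ S k') ∧ (∀ k, S k + ℓ ≤ n))) {k k₀ : Fin M} (hk : k ≠ k₀) (a u : Fin n → Bool) :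
    (∀ x₁ ∈ zblk ℓ S Z k, ∀ x₂ ∈ zblk ℓ S Z k,
        (AffBells22.subcubeMerge (zblk ℓ S Z k₀) a u) x₁ = (AffBells22.subcubeMerge (zblk ℓ S Z k₀) a u) x₂)
      ↔ (∀ x₁ ∈ zblk ℓ S Z k, ∀ x₂ ∈ zblk ℓ S Z k, u x₁ = u x₂) := by
  have hagree : ∀ i, i ∈ zblk ℓ S Z k → AffBells22.subcubeMerge (zblk ℓ S Z k₀) a u i = u i := by
    intro i hi
    unfold AffBells22.subcubeMerge
    rw [if_neg]
    intro hmem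
    exact hk (zblk_unique h hi hmem)
  constructor
  · intro hc i hi i' hi'
    rw [← hagree i hi, ← hagree i' hi']
    exact hc i hi i' hi'
  · intro hc i hi i' hi'
    rw [hagree i hi, hagree i' hi']
    exact hc i hi i' hi'

/-- … while the masked block `k₀` itself becomes constant iff the merged-in bits are. -/
theorem isConstZ_merge_self (k₀ : Fin M) (a u : Fin n → Bool) :
    (∀ x₁ ∈ zblk ℓ S Z k₀, ∀ x₂ ∈ zblk ℓ S Z k₀,
        (AffBells22.subcubeMerge (zblk ℓ S Z k₀) a u) x₁ = (AffBells22.subcubeMerge (zblk ℓ S Z k₀) a u) x₂)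
      ↔ (∀ x₁ ∈ zblk ℓ S Z k₀, ∀ x₂ ∈ zblk ℓ S Z k₀, a x₁ = a x₂) := by
  have hagree : ∀ i, i ∈ zblk ℓ S Z k₀ → AffBells22.subcubeMerge (zblk ℓ S Z k₀) a u i = a i := by
    intro i hi
    unfold AffBells22.subcubeMerge
    rw [if_pos hi]
  constructor
  · intro hc i hi i' hi'
    rw [← hagree i hi, ← hagree i' hi']
    exact hc i hi i' hi'
  · intro hc i hi i' hi'
    rw [hagree i hi, hagree i' hi']
    exact hc i hi i' hi'

/-- merging foreign bits into the masked block `k₀` does not change which EARLIER masked blocks are free. -/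
theorem cblkLTZ_merge (h : ((∀ k k', k < k' → S k + ℓ ≤ S k') ∧ (∀ k, S k + ℓ ≤ n))) {j : ℕ} {k₀ : Fin M} (hj : j ≤ k₀.val) (a u : Fin n → Bool) :
    cblkLTZ ℓ S Z j (AffBells22.subcubeMerge (zblk ℓ S Z k₀) a u) = cblkLTZ ℓ S Z j u := by
  unfold cblkLTZ
  refine Finset.filter_congr fun k _ => ?_
  have hne : k.val < j → k ≠ k₀ := by
    intro hk e
    rw [e] at hk
    omega
  constructor
  · rintro ⟨hk, hc⟩
    exact ⟨hk, (isConstZ_merge_of_ne h (hne hk) a u).mp hc⟩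
  · rintro ⟨hk, hc⟩
    exact ⟨hk, (isConstZ_merge_of_ne h (hne hk) a u).mpr hc⟩

/-- the half-weight factorises over «masked block `j`» × «masked blocks before `j`». -/
theorem ZwZ_succ_merge (h : ((∀ k k', k < k' → S k + ℓ ≤ S k') ∧ (∀ k, S k + ℓ ≤ n))) {j : ℕ} (hj : j < M) (a u : Fin n → Bool) :
    ZwZ ℓ S Z (j + 1) (AffBells22.subcubeMerge (zblk ℓ S Z ⟨j, hj⟩) a u)
      = ZwZ ℓ S Z j u * (if (∀ x₁ ∈ zblk ℓ S Z ⟨j, hj⟩, ∀ x₂ ∈ zblk ℓ S Z ⟨j, hj⟩, a x₁ = a x₂) then (1 / 2 : ℝ) else 1) := by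
  unfold ZwZ
  rw [card_cblkLTZ_succ hj, cblkLTZ_merge h (j := j) (k₀ := ⟨j, hj⟩) (le_refl j) a u, pow_add]
  congr 1
  by_cases hc : (∀ x₁ ∈ zblk ℓ S Z ⟨j, hj⟩, ∀ x₂ ∈ zblk ℓ S Z ⟨j, hj⟩, a x₁ = a x₂)
  · rw [if_pos ((isConstZ_merge_self ⟨j, hj⟩ a u).mpr hc), if_pos hc, pow_one]
  · rw [if_neg (fun hh => hc ((isConstZ_merge_self ⟨j, hj⟩ a u).mp hh)), if_neg hc, pow_zero]

/-- at least `2·2^{n−m}` inputs are constant on a given masked block of size `m ≥ 1` (the two constant sub-cubes). -/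
theorem two_pow_le_card_isConstZ (hm : ∀ k, (zblk ℓ S Z k).card = m) (hm1 : 1 ≤ m) (k : Fin M) :
    2 * 2 ^ (n - m) ≤ (univ.filter fun a : Fin n → Bool => (∀ x₁ ∈ zblk ℓ S Z k, ∀ x₂ ∈ zblk ℓ S Z k, a x₁ = a x₂)).card := by
  set B : Finset (Fin n) := zblk ℓ S Z k with hB
  have hBc : B.card = m := hm k
  let img : Bool → Finset (Fin n → Bool) := fun b => univ.image (Subcube.ext B (fun _ => b))
  have hinj : ∀ b : Bool, Function.Injective (Subcube.ext B (fun _ : Fin n => b)) := fun b =>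
    Function.LeftInverse.injective fun v => Subcube.res_ext B (fun _ => b) v
  have hcard : ∀ b, (img b).card = 2 ^ (n - m) := by
    intro b
    show (univ.image (Subcube.ext B (fun _ => b))).card = _
    rw [Finset.card_image_of_injective _ (hinj b), card_univ, Fintype.card_fun, Fintype.card_bool, Fintype.card_fin, hBc]
  have hsub : ∀ b, img b ⊆ univ.filter fun a : Fin n → Bool => (∀ x₁ ∈ zblk ℓ S Z k, ∀ x₂ ∈ zblk ℓ S Z k, a x₁ = a x₂) := by
    intro b a ha
    rw [mem_filter]
    refine ⟨mem_univ _, ?_⟩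
    obtain ⟨v, _, rfl⟩ := Finset.mem_image.mp ha
    intro i hi i' hi'
    rw [Subcube.ext_of_mem B _ v hi, Subcube.ext_of_mem B _ v hi']
  have hdisj : Disjoint (img true) (img false) := by
    rw [Finset.disjoint_left]
    intro a ha hb
    obtain ⟨v, _, hv⟩ := Finset.mem_image.mp ha
    obtain ⟨v', _, hv'⟩ := Finset.mem_image.mp hb
    obtain ⟨i, hi⟩ := exists_inZ hm hm1 k
    have e1 : a i = true := by rw [← hv, Subcube.ext_of_mem B _ v hi]
    have e2 : a i = false := by rw [← hv', Subcube.ext_of_mem B _ v' hi]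
    rw [e1] at e2
    exact Bool.noConfusion e2
  have hu := Finset.card_union_add_card_inter (img true) (img false)
  rw [Finset.disjoint_iff_inter_eq_empty.mp hdisj, Finset.card_empty, add_zero, hcard, hcard] at hu
  calc 2 * 2 ^ (n - m) = (img true ∪ img false).card := by rw [hu]; ring
    _ ≤ _ := card_le_card (union_subset (hsub true) (hsub false))

/-- the masked-block-`k` factor averages to at most `1 − 2^{−m}`. -/
theorem sum_cfacZ_le (hm : ∀ k, (zblk ℓ S Z k).card = m) (hm1 : 1 ≤ m) (k : Fin M) :
    ∑ a : Fin n → Bool, (if (∀ x₁ ∈ zblk ℓ S Z k, ∀ x₂ ∈ zblk ℓ S Z k, a x₁ = a x₂) then (1 / 2 : ℝ) else 1)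
      ≤ (2 : ℝ) ^ n * (1 - (1 / 2 : ℝ) ^ m) := by
  rw [Finset.sum_ite, Finset.sum_const, Finset.sum_const, nsmul_eq_mul, nsmul_eq_mul, mul_one]
  have htot : ((univ.filter fun a : Fin n → Bool => (∀ x₁ ∈ zblk ℓ S Z k, ∀ x₂ ∈ zblk ℓ S Z k, a x₁ = a x₂)).card : ℝ)
      + ((univ.filter fun a : Fin n → Bool => ¬ (∀ x₁ ∈ zblk ℓ S Z k, ∀ x₂ ∈ zblk ℓ S Z k, a x₁ = a x₂)).card : ℝ) = (2 : ℝ) ^ n := by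
    have e := Finset.card_filter_add_card_filter_not (s := (univ : Finset (Fin n → Bool)))
      (fun a : Fin n → Bool => (∀ x₁ ∈ zblk ℓ S Z k, ∀ x₂ ∈ zblk ℓ S Z k, a x₁ = a x₂))
    rw [card_univ, Fintype.card_fun, Fintype.card_bool, Fintype.card_fin] at e
    exact_mod_cast e
  have hlow : (2 : ℝ) * (2 : ℝ) ^ (n - m)
      ≤ ((univ.filter fun a : Fin n → Bool => (∀ x₁ ∈ zblk ℓ S Z k, ∀ x₂ ∈ zblk ℓ S Z k, a x₁ = a x₂)).card : ℝ) := by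
    exact_mod_cast two_pow_le_card_isConstZ hm hm1 k
  have hpn : m ≤ n := by
    have h1 : (zblk ℓ S Z k).card ≤ (univ : Finset (Fin n)).card := card_le_card (subset_univ _)
    rw [hm k, card_univ, Fintype.card_fin] at h1
    exact h1
  have hsplit : (2 : ℝ) ^ n * (1 / 2 : ℝ) ^ m = (2 : ℝ) ^ (n - m) := by
    have e : (2 : ℝ) ^ n = (2 : ℝ) ^ (n - m) * (2 : ℝ) ^ m := by rw [← pow_add, Nat.sub_add_cancel hpn]
    rw [e, mul_assoc, ← mul_pow]
    norm_num
  rw [mul_sub, mul_one, hsplit]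
  linarith

/-- the moment recursion `Σ Z_{j+1} ≤ (1 − 2^{−m}) Σ Z_j`. -/
theorem sum_ZwZ_succ_le (h : ((∀ k k', k < k' → S k + ℓ ≤ S k') ∧ (∀ k, S k + ℓ ≤ n))) (hm : ∀ k, (zblk ℓ S Z k).card = m) (hm1 : 1 ≤ m)
    {j : ℕ} (hj : j < M) :
    ∑ w : Fin n → Bool, ZwZ ℓ S Z (j + 1) w ≤ (1 - (1 / 2 : ℝ) ^ m) * ∑ u : Fin n → Bool, ZwZ ℓ S Z j u := by
  have key := sum_sum_merge (n := n) (zblk ℓ S Z ⟨j, hj⟩) (ZwZ ℓ S Z (j + 1))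
  have e : (∑ a : Fin n → Bool, ∑ u : Fin n → Bool, ZwZ ℓ S Z (j + 1) (AffBells22.subcubeMerge (zblk ℓ S Z ⟨j, hj⟩) a u))
      = (∑ a : Fin n → Bool, (if (∀ x₁ ∈ zblk ℓ S Z ⟨j, hj⟩, ∀ x₂ ∈ zblk ℓ S Z ⟨j, hj⟩, a x₁ = a x₂) then (1 / 2 : ℝ) else 1))
        * ∑ u : Fin n → Bool, ZwZ ℓ S Z j u := by
    rw [Finset.sum_mul_sum]
    refine Finset.sum_congr rfl fun a _ => Finset.sum_congr rfl fun u _ => ?_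
    rw [ZwZ_succ_merge h hj, mul_comm]
  rw [e] at key
  have hZ : 0 ≤ ∑ u : Fin n → Bool, ZwZ ℓ S Z j u := Finset.sum_nonneg fun u _ => by unfold ZwZ; positivity
  have hc := sum_cfacZ_le hm hm1 ⟨j, hj⟩
  have h2n : (0 : ℝ) < (2 : ℝ) ^ n := by positivity
  have hmain : (2 : ℝ) ^ n * ∑ w : Fin n → Bool, ZwZ ℓ S Z (j + 1) w
      ≤ (2 : ℝ) ^ n * ((1 - (1 / 2 : ℝ) ^ m) * ∑ u : Fin n → Bool, ZwZ ℓ S Z j u) := by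
    rw [← key, ← mul_assoc]
    exact mul_le_mul_of_nonneg_right hc hZ
  exact le_of_mul_le_mul_left hmain h2n

/-- the moment bound `Σ_u (1/2)^{#free masked blocks among first j} ≤ 2ⁿ (1 − 2^{−m})^j`. -/
theorem sum_ZwZ_le (h : ((∀ k k', k < k' → S k + ℓ ≤ S k') ∧ (∀ k, S k + ℓ ≤ n))) (hm : ∀ k, (zblk ℓ S Z k).card = m) (hm1 : 1 ≤ m) :
    ∀ j, j ≤ M → ∑ u : Fin n → Bool, ZwZ ℓ S Z j u ≤ (2 : ℝ) ^ n * (1 - (1 / 2 : ℝ) ^ m) ^ j := by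
  intro j
  induction j with
  | zero =>
    intro _
    have e : ∀ u : Fin n → Bool, ZwZ ℓ S Z 0 u = 1 := fun u => by
      unfold ZwZ
      rw [cblkLTZ_zero, Finset.card_empty, pow_zero]
    simp_rw [e]
    rw [Finset.sum_const, Finset.card_univ, Fintype.card_fun, Fintype.card_bool, Fintype.card_fin, nsmul_eq_mul, mul_one,
      pow_zero, mul_one]
    push_cast
    exact le_refl _
  | succ j ih =>
    intro hj
    have hq : 0 ≤ 1 - (1 / 2 : ℝ) ^ m := by
      have : (1 / 2 : ℝ) ^ m ≤ 1 := pow_le_one₀ (by norm_num) (by norm_num)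
      linarith
    calc ∑ u : Fin n → Bool, ZwZ ℓ S Z (j + 1) u ≤ (1 - (1 / 2 : ℝ) ^ m) * ∑ u : Fin n → Bool, ZwZ ℓ S Z j u :=
          sum_ZwZ_succ_le h hm hm1 (by omega)
      _ ≤ (1 - (1 / 2 : ℝ) ^ m) * ((2 : ℝ) ^ n * (1 - (1 / 2 : ℝ) ^ m) ^ j) := mul_le_mul_of_nonneg_left (ih (by omega)) hq
      _ = (2 : ℝ) ^ n * (1 - (1 / 2 : ℝ) ^ m) ^ (j + 1) := by ring

/-- Markov: `#{u : at most T free masked blocks} · (1/2)^T ≤ 2ⁿ (1 − 2^{−m})^M`. -/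
theorem card_few_constZ_le (h : ((∀ k k', k < k' → S k + ℓ ≤ S k') ∧ (∀ k, S k + ℓ ≤ n))) (hm : ∀ k, (zblk ℓ S Z k).card = m) (hm1 : 1 ≤ m)
    (T : ℕ) :
    ((univ.filter fun u : Fin n → Bool => (cblkZ ℓ S Z u).card ≤ T).card : ℝ) * (1 / 2 : ℝ) ^ T
      ≤ (2 : ℝ) ^ n * (1 - (1 / 2 : ℝ) ^ m) ^ M := by
  refine le_trans ?_ (sum_ZwZ_le h hm hm1 M le_rfl)
  have e : ((univ.filter fun u : Fin n → Bool => (cblkZ ℓ S Z u).card ≤ T).card : ℝ) * (1 / 2 : ℝ) ^ T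
      = ∑ _u ∈ univ.filter (fun u : Fin n → Bool => (cblkZ ℓ S Z u).card ≤ T), (1 / 2 : ℝ) ^ T := by
    rw [Finset.sum_const, nsmul_eq_mul]
  rw [e]
  calc ∑ _u ∈ univ.filter (fun u : Fin n → Bool => (cblkZ ℓ S Z u).card ≤ T), (1 / 2 : ℝ) ^ T
      ≤ ∑ u ∈ univ.filter (fun u : Fin n → Bool => (cblkZ ℓ S Z u).card ≤ T), ZwZ ℓ S Z M u := by
        refine Finset.sum_le_sum fun u hu => ?_
        rw [mem_filter] at hu
        unfold ZwZ
        rw [cblkLTZ_M]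
        exact pow_le_pow_of_le_one (by norm_num) (by norm_num) hu.2
    _ ≤ ∑ u, ZwZ ℓ S Z M u :=
        Finset.sum_le_sum_of_subset_of_nonneg (filter_subset _ _) fun u _ _ => by unfold ZwZ; positivity

/-- **THE FREE-MASKED-BLOCK TAIL**: with `M ≥ 2^m (T+1)` masked blocks of size `m ≥ 1`, at most HALF of all inputs are constant on `≤ T` of them. -/
theorem card_few_constZ_le_half (h : ((∀ k k', k < k' → S k + ℓ ≤ S k') ∧ (∀ k, S k + ℓ ≤ n))) (hm : ∀ k, (zblk ℓ S Z k).card = m)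
    (hm1 : 1 ≤ m) (T : ℕ) (hM : 2 ^ m * (T + 1) ≤ M) :
    ((univ.filter fun u : Fin n → Bool => (cblkZ ℓ S Z u).card ≤ T).card : ℝ) ≤ (2 : ℝ) ^ n / 2 := by
  have h1 := card_few_constZ_le h hm hm1 T
  set q : ℝ := 1 - (1 / 2 : ℝ) ^ m with hq
  have hq0 : 0 ≤ q := by
    have : (1 / 2 : ℝ) ^ m ≤ 1 := pow_le_one₀ (by norm_num) (by norm_num)
    rw [hq]; linarith
  have hq1 : q ≤ 1 := by
    have : (0 : ℝ) ≤ (1 / 2 : ℝ) ^ m := by positivity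
    rw [hq]; linarith
  have hqM : q ^ M ≤ (1 / 2 : ℝ) ^ (T + 1) := by
    calc q ^ M ≤ q ^ (2 ^ m * (T + 1)) := pow_le_pow_of_le_one hq0 hq1 hM
      _ = (q ^ (2 ^ m)) ^ (T + 1) := pow_mul q (2 ^ m) (T + 1)
      _ ≤ (1 / 2 : ℝ) ^ (T + 1) := pow_le_pow_left₀ (by positivity) (qpow_le_half m) _
  have hT : (0 : ℝ) < (1 / 2 : ℝ) ^ T := by positivity
  have hmain : ((univ.filter fun u : Fin n → Bool => (cblkZ ℓ S Z u).card ≤ T).card : ℝ) * (1 / 2 : ℝ) ^ T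
      ≤ ((2 : ℝ) ^ n / 2) * (1 / 2 : ℝ) ^ T := by
    calc _ ≤ (2 : ℝ) ^ n * q ^ M := h1
      _ ≤ (2 : ℝ) ^ n * (1 / 2 : ℝ) ^ (T + 1) := mul_le_mul_of_nonneg_left hqM (by positivity)
      _ = ((2 : ℝ) ^ n / 2) * (1 / 2 : ℝ) ^ T := by rw [pow_succ]; ring
  exact le_of_mul_le_mul_right hmain hT

end MaskTail

end Summit.QuantumAdvantage.AdviceFreeQNC0.JLinPeel.MaskDial
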